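import Mathlib
import HarnessLib
import Summits.NavierStokesRegularity.NavierStokesRegularity.Theorems.ThreadingFluxHorizonTowerZonalBridge

/-!
# Route `UnthreadedRigidityDoor`, item `UnthreadedRigidity` (W2, stmt-NavierStokesRegularity-27585) — LINE g11-1 «VIRIAL HORN»:
# SOLID HARMONICS OF DEGREE `l` ARE SPANNED BY ANY `2l+1` OF THEM WITH INDEPENDENT `z`-TRACES (the span step of bracket injectivity, all degrees)

Director KEY-NS #210 (W-i per degree / W-ii all `l`).  The frame reduction `bracketInjective_of_frame` (p716639) needs, in each degree, (a′) a frame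
spanning the solid harmonics of that degree and (b′) a bracket certificate.  Degrees 2 and 3 used the identifications `exists_quadY_of_isHomogeneous_two`
and W1's `exists_cubicHE3_of_harmonic_homogeneous`; this file replaces the identification step ONCE FOR ALL DEGREES by linear algebra on coefficients:

* `eq_zero_of_lapP_of_coeff_le_one` — a polynomial `P` in three variables with `lapP P = 0` whose coefficients of `z`-degree `0` and `1` all vanish is
  zero (the harmonic recursion `(k+2)(k+1) c_{a,b,k+2} = −(a+2)(a+1) c_{a+2,b,k} − (b+2)(b+1) c_{a,b+2,k}`, induction on the `z`-degree);
* `exists_eq_sum_smul_of_traces` — if `F₀,…,F_{2l}` are homogeneous of degree `l` with `lapP F_k = 0` and their `2l+1` TRACE VECTORS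
  (coefficients of `x^a y^{l−a}` and `x^b y^{l−1−b} z`) are linearly independent, then every homogeneous `P` of degree `l` with `lapP P = 0` is
  `Σ c_k F_k` (so `dim 𝓗_l ≤ 2l+1`);
* `exists_eq_sum_smul_of_linearIndependent` — the same with «the `F_k` are linearly independent polynomials» as the hypothesis (any `2l+1` independent
  solid harmonics of degree `l` are a basis), so per-degree bracket injectivity becomes a finite certificate in EVERY degree;
* `isHomogeneous_of_evalE_smul` — homogeneity of an explicit polynomial from the dilation law of its function (to certify frames).

HONEST LABEL: finite-dimensional algebra (coefficients of harmonic polynomials); `UnthreadedRigidity` (27585), bridge W (all degrees), W2 and NS regularity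
remain OPEN; nothing here is a statement about Navier–Stokes solutions.  `--supports stmt-NavierStokesRegularity-27585` (helper); ns-crc-p2 g9; 0 kit.
[folklore]
-/

-- the summit and its single sub-problem share the name (CONVENTIONS §1)
set_option linter.dupNamespace false

namespace Summit.NavierStokesRegularity.NavierStokesRegularity.Theorems.UnthreadedRigidity.VirialHorn

open MvPolynomial Finsupp
open Summit.NavierStokesRegularity.NavierStokesRegularity.Theorems.PoloidalLiouville.HorizonTower (Zonal.lapP Zonal.evalE)

/-! ## The harmonic recursion on coefficients -/

/-- coefficient of a second partial derivative: `coeff m (∂ᵢ∂ᵢ P) = coeff (m + 2eᵢ) P · (mᵢ+2)(mᵢ+1)`. -/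
theorem coeff_pderiv_pderiv_self (i : Fin 3) (P : MvPolynomial (Fin 3) ℝ) (m : Fin 3 →₀ ℕ) :
    coeff m (pderiv i (pderiv i P)) = coeff (m + single i 2) P * (((m i : ℝ) + 2) * ((m i : ℝ) + 1)) := by
  rw [coeff_pderiv, coeff_pderiv]
  have h1 : (m + single i 1 : Fin 3 →₀ ℕ) i = m i + 1 := by simp
  have h2 : (m + single i 1 + single i 1 : Fin 3 →₀ ℕ) = m + single i 2 := by
    rw [add_assoc, ← single_add]
  rw [h1, h2]
  push_cast
  ring

/-- the coefficient form of `lapP P = 0`: for every exponent `m`,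
`(m₀+2)(m₀+1) c_{m+2e₀} + (m₁+2)(m₁+1) c_{m+2e₁} + (m₂+2)(m₂+1) c_{m+2e₂} = 0`. -/
theorem coeff_recursion_of_lapP {P : MvPolynomial (Fin 3) ℝ} (hlap : Zonal.lapP P = 0) (m : Fin 3 →₀ ℕ) :
    coeff (m + single 0 2) P * (((m 0 : ℝ) + 2) * ((m 0 : ℝ) + 1))
      + coeff (m + single 1 2) P * (((m 1 : ℝ) + 2) * ((m 1 : ℝ) + 1))
      + coeff (m + single 2 2) P * (((m 2 : ℝ) + 2) * ((m 2 : ℝ) + 1)) = 0 := by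
  have h := congrArg (coeff m) hlap
  rw [Zonal.lapP, coeff_add, coeff_add, coeff_pderiv_pderiv_self, coeff_pderiv_pderiv_self, coeff_pderiv_pderiv_self,
    coeff_zero] at h
  exact h

/-- ★ A polynomial in three variables with vanishing flat Laplacian whose coefficients of `z`-degree `≤ 1` all vanish is zero. -/
theorem eq_zero_of_lapP_of_coeff_le_one {P : MvPolynomial (Fin 3) ℝ} (hlap : Zonal.lapP P = 0)
    (h0 : ∀ d : Fin 3 →₀ ℕ, d 2 ≤ 1 → coeff d P = 0) : P = 0 := by
  -- all `z`-layers vanish, by strong induction on the `z`-degree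
  have key : ∀ n : ℕ, ∀ d : Fin 3 →₀ ℕ, d 2 = n → coeff d P = 0 := by
    intro n
    induction n using Nat.strong_induction_on with
    | _ n ih =>
      intro d hd
      rcases Nat.lt_or_ge n 2 with hn | hn
      · exact h0 d (by omega)
      · -- write `d = m + 2 e₂` with `m₂ = n - 2`
        obtain ⟨k, hk⟩ := Nat.exists_eq_add_of_le hn
        set m : Fin 3 →₀ ℕ := d - single 2 2 with hm
        have hd2 : 2 ≤ d 2 := by omega
        have hdm : d = m + single 2 2 := by
          ext i
          rw [hm, Finsupp.add_apply, Finsupp.tsub_apply, Finsupp.single_apply]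
          fin_cases i
          · simp
          · simp
          · simp only [Fin.reduceFinMk, if_true]
            omega
        have hm2 : m 2 = k := by
          rw [hm, Finsupp.tsub_apply, single_eq_same]; omega
        have hrec := coeff_recursion_of_lapP hlap m
        have hz0 : coeff (m + single 0 2) P = 0 := ih k (by omega) _ (by simp [hm2])
        have hz1 : coeff (m + single 1 2) P = 0 := ih k (by omega) _ (by simp [hm2])
        rw [hz0, hz1, zero_mul, zero_mul, zero_add, zero_add, ← hdm, hm2] at hrec
        have hpos : ((k : ℝ) + 2) * ((k : ℝ) + 1) ≠ 0 := by positivity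
        exact (mul_eq_zero.mp hrec).resolve_right hpos
  ext d
  rw [coeff_zero]
  exact key (d 2) d rfl

/-! ## Traces: a degree-`l` harmonic polynomial is determined by its coefficients of `z`-degree `0` and `1` -/

/-- the exponent `(a, l−a, 0)`. -/
theorem trace_exponent_zero (l : ℕ) (d : Fin 3 →₀ ℕ) (hdeg : d 0 + d 1 + d 2 = l) (h2 : d 2 = 0) :
    d = single 0 (d 0) + single 1 (l - d 0) := by
  ext i
  fin_cases i
  · simp
  · simp only [Fin.mk_one, Finsupp.add_apply, single_eq_same, Finsupp.single_apply]
    simp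
    omega
  · simp only [Fin.reduceFinMk, Finsupp.add_apply, Finsupp.single_apply]
    simp
    omega

/-- the exponent `(b, l−1−b, 1)`. -/
theorem trace_exponent_one (l : ℕ) (d : Fin 3 →₀ ℕ) (hdeg : d 0 + d 1 + d 2 = l) (h2 : d 2 = 1) :
    d = single 0 (d 0) + single 1 (l - 1 - d 0) + single 2 1 := by
  ext i
  fin_cases i
  · simp
  · simp only [Fin.mk_one, Finsupp.add_apply, single_eq_same, Finsupp.single_apply]
    simp
    omega
  · simp only [Fin.reduceFinMk, Finsupp.add_apply, Finsupp.single_apply]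
    simp
    omega

/-- degree of an exponent of a homogeneous polynomial in three variables, written out. -/
theorem degree_eq_of_coeff_ne_zero {l : ℕ} {P : MvPolynomial (Fin 3) ℝ} (hP : P.IsHomogeneous l) {d : Fin 3 →₀ ℕ}
    (hd : coeff d P ≠ 0) : d 0 + d 1 + d 2 = l := by
  have h1 := hP hd
  have h2 : Finsupp.degree d = l := by rw [Finsupp.degree_eq_weight_one]; exact h1
  rw [Finsupp.degree_eq_sum, Fin.sum_univ_three] at h2
  exact h2

/-- ★ UNIQUENESS BY TRACES: a homogeneous `P` of degree `l` with `lapP P = 0` whose trace coefficients `c_{a,l−a,0}` (`a ≤ l`) and `c_{b,l−1−b,1}`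
(`b < l`) vanish is zero. -/
theorem eq_zero_of_traces {l : ℕ} {P : MvPolynomial (Fin 3) ℝ} (hP : P.IsHomogeneous l) (hlap : Zonal.lapP P = 0)
    (ht0 : ∀ a : Fin (l + 1), coeff (single 0 (a : ℕ) + single 1 (l - a)) P = 0)
    (ht1 : ∀ b : Fin l, coeff (single 0 (b : ℕ) + single 1 (l - 1 - b) + single 2 1) P = 0) : P = 0 := by
  refine eq_zero_of_lapP_of_coeff_le_one hlap fun d hd2 => ?_
  by_contra hne
  have hdeg := degree_eq_of_coeff_ne_zero hP hne
  rcases Nat.lt_or_ge (d 2) 1 with h | h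
  · have h0 : d 2 = 0 := by omega
    have hd := trace_exponent_zero l d hdeg h0
    have ha : d 0 < l + 1 := by omega
    have := ht0 ⟨d 0, ha⟩
    rw [← hd] at this
    exact hne this
  · have h1 : d 2 = 1 := by omega
    have hd := trace_exponent_one l d hdeg h1
    have hb : d 0 < l := by omega
    have := ht1 ⟨d 0, hb⟩
    rw [← hd] at this
    exact hne this

/-! ## ★ Span from independent traces -/

/-- `lapP` of a linear combination. -/
theorem lapP_sum_smul {ι : Type*} (s : Finset ι) (c : ι → ℝ) (F : ι → MvPolynomial (Fin 3) ℝ) :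
    Zonal.lapP (∑ k ∈ s, c k • F k) = ∑ k ∈ s, c k • Zonal.lapP (F k) := by
  simp only [Zonal.lapP, map_sum, MvPolynomial.smul_eq_C_mul, pderiv_C_mul, mul_add, Finset.sum_add_distrib]

/-- ★ **SPAN FROM INDEPENDENT TRACES** (all degrees): if `F₀,…,F_{2l}` are homogeneous of degree `l` with `lapP F_k = 0` and their trace vectors
`(coeff (a,l−a,0) F_k)_{a ≤ l} ⊕ (coeff (b,l−1−b,1) F_k)_{b < l} ∈ ℝ^{l+1} × ℝ^{l}` are linearly independent, then every homogeneous `P` of degree `l`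
with `lapP P = 0` is a linear combination of the `F_k`. -/
theorem exists_eq_sum_smul_of_traces {l : ℕ} (F : Fin (2 * l + 1) → MvPolynomial (Fin 3) ℝ)
    (hFh : ∀ k, (F k).IsHomogeneous l) (hFl : ∀ k, Zonal.lapP (F k) = 0)
    (hind : LinearIndependent ℝ (fun k : Fin (2 * l + 1) =>
      ((fun a : Fin (l + 1) => coeff (single 0 (a : ℕ) + single 1 (l - a)) (F k),
        fun b : Fin l => coeff (single 0 (b : ℕ) + single 1 (l - 1 - b) + single 2 1) (F k)) : (Fin (l + 1) → ℝ) × (Fin l → ℝ))))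
    {P : MvPolynomial (Fin 3) ℝ} (hP : P.IsHomogeneous l) (hlap : Zonal.lapP P = 0) :
    ∃ c : Fin (2 * l + 1) → ℝ, P = ∑ k, c k • F k := by
  classical
  -- the trace map
  set τ : MvPolynomial (Fin 3) ℝ → (Fin (l + 1) → ℝ) × (Fin l → ℝ) := fun Q =>
    ((fun a : Fin (l + 1) => coeff (single 0 (a : ℕ) + single 1 (l - a)) Q,
      fun b : Fin l => coeff (single 0 (b : ℕ) + single 1 (l - 1 - b) + single 2 1) Q)) with hτ
  have hτ_lin : ∀ (c : Fin (2 * l + 1) → ℝ), τ (∑ k, c k • F k) = ∑ k, c k • τ (F k) := by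
    intro c
    refine Prod.ext ?_ ?_
    · funext a
      simp only [hτ, Prod.fst_sum, Finset.sum_apply, Prod.smul_fst, Pi.smul_apply, smul_eq_mul, coeff_sum, coeff_smul]
    · funext b
      simp only [hτ, Prod.snd_sum, Finset.sum_apply, Prod.smul_snd, Pi.smul_apply, smul_eq_mul, coeff_sum, coeff_smul]
  -- the traces of the frame form a basis of the trace space (independent, full cardinality)
  have hcard : Fintype.card (Fin (2 * l + 1)) = Module.finrank ℝ ((Fin (l + 1) → ℝ) × (Fin l → ℝ)) := by
    rw [Module.finrank_prod, Module.finrank_fin_fun, Module.finrank_fin_fun, Fintype.card_fin]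
    ring
  have hspan : Submodule.span ℝ (Set.range fun k => τ (F k)) = ⊤ :=
    hind.span_eq_top_of_card_eq_finrank' hcard
  have hmem : τ P ∈ Submodule.span ℝ (Set.range fun k => τ (F k)) := by rw [hspan]; exact Submodule.mem_top
  obtain ⟨c, hc⟩ := (Submodule.mem_span_range_iff_exists_fun (R := ℝ)).1 hmem
  refine ⟨c, ?_⟩
  -- the difference has zero traces, is homogeneous and harmonic, hence vanishes
  have hQh : (P - ∑ k, c k • F k).IsHomogeneous l :=
    hP.sub (MvPolynomial.IsHomogeneous.sum _ _ l fun k _ => by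
      rw [MvPolynomial.smul_eq_C_mul]
      simpa using (MvPolynomial.isHomogeneous_C (Fin 3) (c k)).mul (hFh k))
  have hQl : Zonal.lapP (P - ∑ k, c k • F k) = 0 := by
    have hs : Zonal.lapP (∑ k, c k • F k) = 0 := by
      rw [lapP_sum_smul]; simp [hFl]
    simp only [Zonal.lapP, map_sub] at hs ⊢
    rw [Zonal.lapP] at hlap
    linear_combination hlap - hs
  have hQτ : τ (P - ∑ k, c k • F k) = 0 := by
    have h1 : τ (P - ∑ k, c k • F k) = τ P - τ (∑ k, c k • F k) := by
      refine Prod.ext ?_ ?_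
      · funext a
        simp only [hτ, Prod.fst_sub, Pi.sub_apply, coeff_sub]
      · funext b
        simp only [hτ, Prod.snd_sub, Pi.sub_apply, coeff_sub]
    rw [h1, hτ_lin, hc, sub_self]
  have hzero := eq_zero_of_traces hQh hQl
    (fun a => by have := congrArg (fun v => v.1 a) hQτ; simpa [hτ] using this)
    (fun b => by have := congrArg (fun v => v.2 b) hQτ; simpa [hτ] using this)
  exact (sub_eq_zero.mp hzero)

/-- ★ **SPAN FROM LINEAR INDEPENDENCE** (all degrees; the form the per-degree certificates use): if `F₀,…,F_{2l}` are LINEARLY INDEPENDENT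
homogeneous polynomials of degree `l` with `lapP F_k = 0`, then every homogeneous `P` of degree `l` with `lapP P = 0` is `Σ c_k F_k` — i.e. any
`2l+1` independent solid harmonics of degree `l` are a basis (`dim 𝓗_l = 2l+1` from below and above).  Independence of the traces follows from
independence of the polynomials through `eq_zero_of_traces`. -/
theorem exists_eq_sum_smul_of_linearIndependent {l : ℕ} (F : Fin (2 * l + 1) → MvPolynomial (Fin 3) ℝ)
    (hFh : ∀ k, (F k).IsHomogeneous l) (hFl : ∀ k, Zonal.lapP (F k) = 0) (hind : LinearIndependent ℝ F)
    {P : MvPolynomial (Fin 3) ℝ} (hP : P.IsHomogeneous l) (hlap : Zonal.lapP P = 0) :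
    ∃ c : Fin (2 * l + 1) → ℝ, P = ∑ k, c k • F k := by
  refine exists_eq_sum_smul_of_traces F hFh hFl ?_ hP hlap
  rw [Fintype.linearIndependent_iff] at hind ⊢
  intro g hg
  apply hind g
  -- the combination `Σ g_k F_k` is homogeneous, harmonic, and has zero traces
  have hQh : (∑ k, g k • F k).IsHomogeneous l :=
    MvPolynomial.IsHomogeneous.sum _ _ l fun k _ => by
      rw [MvPolynomial.smul_eq_C_mul]
      simpa using (MvPolynomial.isHomogeneous_C (Fin 3) (g k)).mul (hFh k)
  have hQl : Zonal.lapP (∑ k, g k • F k) = 0 := by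
    rw [lapP_sum_smul]
    simp [hFl]
  have h0 : ∀ a : Fin (l + 1), coeff (single 0 (a : ℕ) + single 1 (l - a)) (∑ k, g k • F k) = 0 := fun a => by
    have := congrArg (fun v => v.1 a) hg
    simpa only [Prod.fst_sum, Finset.sum_apply, Prod.smul_fst, Pi.smul_apply, smul_eq_mul, Prod.fst_zero,
      Pi.zero_apply, coeff_sum, coeff_smul] using this
  have h1 : ∀ b : Fin l, coeff (single 0 (b : ℕ) + single 1 (l - 1 - b) + single 2 1) (∑ k, g k • F k) = 0 := fun b => by
    have := congrArg (fun v => v.2 b) hg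
    simpa only [Prod.snd_sum, Finset.sum_apply, Prod.smul_snd, Pi.smul_apply, smul_eq_mul, Prod.snd_zero,
      Pi.zero_apply, coeff_sum, coeff_smul] using this
  exact eq_zero_of_traces hQh hQl h0 h1

/-! ## Homogeneity of an explicit polynomial from the homogeneity of its function -/

/-- a polynomial whose FUNCTION `evalE T` is homogeneous of degree `l` under all real dilations is a homogeneous polynomial of degree `l`
(W1's `Zonal.exists_mvPolynomial_of_homogeneous` + injectivity of `evalE`); the convenient way to certify homogeneity of an explicit frame. -/
theorem isHomogeneous_of_evalE_smul (T : MvPolynomial (Fin 3) ℝ) (l : ℕ)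
    (h : ∀ (c : ℝ) (y : EuclideanSpace ℝ (Fin 3)), Zonal.evalE T (c • y) = c ^ l * Zonal.evalE T y) : T.IsHomogeneous l := by
  obtain ⟨p, hph, hpe⟩ :=
    Summit.NavierStokesRegularity.NavierStokesRegularity.Theorems.PoloidalLiouville.HorizonTower.Zonal.exists_mvPolynomial_of_homogeneous
      (Summit.NavierStokesRegularity.NavierStokesRegularity.Theorems.PoloidalLiouville.HorizonTower.Zonal.contDiff_evalE T) h
  have hTp : T - p = 0 :=
    Summit.NavierStokesRegularity.NavierStokesRegularity.Theorems.PoloidalLiouville.HorizonTower.Zonal.eq_zero_of_evalE_eq_zero fun y => by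
      rw [Summit.NavierStokesRegularity.NavierStokesRegularity.Theorems.PoloidalLiouville.HorizonTower.Zonal.evalE_sub, hpe y, sub_self]
  rw [sub_eq_zero.mp hTp]
  exact hph

end Summit.NavierStokesRegularity.NavierStokesRegularity.Theorems.UnthreadedRigidity.VirialHorn
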